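import Mathlib
import HarnessLib
import HarnessLib.Audit
import Summits.AtomisticToContinuum.Statement
import Literature.Geometry.DiscreteGeometry.TwoShellPatterns
import Literature.MathematicalPhysics.StatisticalMechanics.BarlowStacking
import Literature.MathematicalPhysics.StatisticalMechanics.HaggStacking
import HarnessLib.Audit.Status.Attr

/-!
Route: CohesionFrustrationStrain

# Route CohesionFrustrationStrain — cohesion, interior two-shell order and strain relaxation close
Crystallization via landed glue

decomp-a2c NODE (lens «barrier-complement carving», gen 0; conjunct-level child of the trivial 4-way
AND
`AtomisticToContinuum_iff`). It suffices to show X = Cohesion ∧ InteriorTwoShellOrder ∧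
StrainRelaxation: along
every sequence of Lennard-Jones ground states in ℝ³ (1) the fraction of EXPOSED particles (an empty
ball of radius
9/10 centred within distance 1) tends to 0; (2) the fraction of particles that are fully surrounded
yet not
(1/20,[47/50,1])-two-shell-good (fcc OR hcp 18-point pattern) tends to 0; (3) if the two-shell-bad
fraction tends to
0 then for every η > 0 the fraction of particles whose 2-ball is not η-layered
(PrestressSplitKorn.LayeredNear, any
Hägg word) tends to 0. (1)+(2) give the bad fraction F1 by a union bound, (3) gives F2, and the
LANDED theorem
PhononSlackCertificatesNearFarGlueR.crystallization_of_fractions (carried verbatim as the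
provable-now support FractionsGlue) gives Crystallization.
Lean: `Cohesion ∧ InteriorTwoShellOrder ∧ StrainRelaxation`

## Assembly
Pure logic plus one landed theorem: Nat.card{¬good} ≤ Nat.card{exposed} + Nat.card{¬exposed ∧ ¬good}
(a bad particle is
exposed or interior-bad; the interior predicate is the negation of Exposed by
not_exists/not_and/not_forall/not_lt), so
Cohesion + InteriorTwoShellOrder squeeze the bad fraction F1 to 0; StrainRelaxation applied to F1
gives F2 per sequence;
FractionsGlue F1 F2 : Crystallization (FractionsGlue = the PROVED theorem
PhononSlackCertificatesNearFarGlueR.crystallization_of_fractions,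
carried as a provable-now support binder because its module is unbuilt on the hub today). The
deciding theorem `closes` (glue.lean) is this proof.

Rationale: WHY THIS LINE. The only open route of the sub (FreeSplittingCertificates) is blocked on
StrictSplittingRule (stmt-AtomisticToContinuum-12560),
an exact finite-range hcp-pinning certificate that the cell's census reads as STRONGER than
Crystallization and that sits inside
ShortRangeStackingBlindness (it must separate hcp from fcc, gap 7.27e-5) and
AperiodicTilingGroundStates (exact certificates).
The tree already contains, invisible to the census, the two-fraction glue
crystallization_of_fractions (stacking selection
LayeredHull.PeriodicGivenLayered_of, hull extraction and window optimality behind it), whose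
hypotheses are stacking-blind a.e.
statements not known to imply Crystallization. This line carves those hypotheses along the
catalogued barriers: the vacuum-adjacency
predicate splits F1 EXACTLY into a pattern-free cohesion statement (outside every local-order
barrier by construction) and the
interior frustration kernel (the barrier-certified, LP-instrumentable axis), and F2 is filed in its
conditional form (local order
as hypothesis, outside the frustration barriers; smooth energy, outside FccShellUnlocking). Sources:
BlancLewin2015 §2.3,
HalesDSP2012 Thm 8.44, Theil2006, FlatleyTheil2015, HeitmannRadin1980; imported area: geometric
rigidity (Friesecke–James–Müller)
for (3), LP duality certificates for (2). Negatives steered around: ShellCensus stmt-15929 (no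
pointwise shell claim),
EffectiveLocalHales 4146, OneGrainGluing 3506.

RANKED CRUXES. #2 InteriorTwoShellOrder (crux) — along every sequence of Lennard-Jones ground states
the fraction of particles that are not exposed (every point within distance 1 of the particle has a
particle centre within 9/10) and are not (1/20,[47/50,1])-two-shell-good tends to zero — the
frustration kernel of F1. [difficulty: open-problem] (why it might fail: tetrahedral frustration:
icosahedral / Frank–Kasper / polytetrahedral interior environments within o(1)·N of the ground
energy at positive density (Rogers–Hales local bounds are not sharp; LJ tail rewards over-dense
shells).) [HalesDSP2012, FlatleyTheil2015, BlancLewin2015,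
Literature.Barriers.AtomisticToContinuum.TetrahedralFrustration, stmt-AtomisticToContinuum-12562]
#3 Cohesion (crux) — along every sequence of Lennard-Jones ground states the fraction of exposed
particles — those with a point y, dist y (x i) ≤ 1, whose open 9/10-ball contains no particle centre
— tends to zero (no foam / no internal surface of positive density). [difficulty: L] (why it might
fail: the radius 9/10 is tight against relaxed close packing (hole covering radius ≈ 0.71–0.77 after
6% contraction): a strained but crystalline bulk could expose sites at positive density, making the
piece false while F1 holds only if the good-window excludes it (it does: margin 0.08).)
[BlancLewin2015, HeitmannRadin1980, Theil2006, stmt-AtomisticToContinuum-2912]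
#4 StrainRelaxation (crux) — along every sequence of Lennard-Jones ground states whose two-shell-bad
fraction tends to zero, for every η > 0 the fraction of particles whose 2-ball is not η-layered-near
(PrestressSplitKorn.LayeredNear η: two-way η-matching with a rigid image of a layered template of
arbitrary Hägg word, a ∈ [47/50,1], interlayer increments in [39a/50,17a/20]) tends to zero.
[difficulty: L] (why it might fail: sparse (o(N)) two-shell defects can still bend layers: a
dislocation/disclination network of vanishing density but divergent strain reach makes LayeredNear η
fail at positive density for small η unless elastic energy controls the far field.)
[FrieseckeJamesMueller2002, Theil2006, FlatleyTheil2015, stmt-AtomisticToContinuum-13958,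
stmt-AtomisticToContinuum-11778]
#9 FractionsGlue (support) — the landed two-fraction glue, PROVED in tree
(Theorems/PhononSlackCertificatesNearFarGlueRRouteNeeds.lean,
`PhononSlackCertificatesNearFarGlueR.crystallization_of_fractions`): (F1: a.e. particle
two-shell-good along every ground-state sequence) → (F2: ∀ η > 0 a.e. particle η-layered-near) →
Crystallization; restated by delta-expansion of PrestressSplitKorn.LayeredNear only because that
module has no hub olean today (lean check rc 75 remote:stale:148:unbuilt) — closes by `exact
crystallization_of_fractions` once the build backlog clears. [difficulty: provable-now]
[stmt-AtomisticToContinuum-14970, stmt-AtomisticToContinuum-11779, BlancLewin2015]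

TWO-LAYER PLAN. InteriorTwoShellOrder ⇐ (ε-deficit stacking-blind finite-range splitting certificate
for the {fcc,hcp} two-shell target, the
re-targeted rung of FreeSplittingCertificates.ApproxFiniteRangeSplitting) → (deficit ε below the
certified margin forces density
→ 0 of uncertified interior sites) → InteriorTwoShellOrder. Cohesion ⇐
SurfaceTensionNoFoam.ExposedSitesCost-type removal bound →
insertion gain at radius 9/10 → Cohesion. StrainRelaxation ⇐
PhononSlackCertificates.NearFieldConvexity (landed implication
nonLayeredFraction_of_nearFieldConvexity). Nothing filed now.

KILL CRITERIA. A ground-state sequence (or a periodic competitor within o(N) of the ground energy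
made rigorous) with positive density of
interior non-close-packed two-shell environments refutes InteriorTwoShellOrder and closes the route
(refuted:InteriorTwoShellOrder);
a certified relaxed-Barlow phonon instability in the box a ∈ [47/50,1] refutes StrainRelaxation
(pivot: widen the LayeredNear
template box, new item); Cohesion refuted at radius 9/10 (strained crystalline bulk exposing sites)
⇒ pivot to radius 1 with
the good-window margin recomputed. FreeSplittingCertificates closing StrictSplittingRule moots the
route (superseded).

NOT DECOMPOSED YET. The certificate form of InteriorTwoShellOrder (target polytope, range, ε), the
removal-cost lemma behind Cohesion, and the
elastic far-field estimate behind StrainRelaxation are layer-2 children; constants (1/20, 47/50,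
9/10, the LayeredNear box)
are those of the landed glue and are not re-tuned here.

CHEAPEST FALSIFIER. Re-target the b2b-freesplit ε-LP engine (Cruxes/StrictSplittingRule, CERT
§44–48, jobs j027716–j028157) from the hcp
two-shell pattern to the stacking-blind {fcc, hcp} two-shell target with ε-feasibility:
infeasibility at every range
R ≤ 3 with margin demand 1e-3 kills the instrument lane of InteriorTwoShellOrder (the crux itself
survives only as a
BARRIER leaf). Not run here (kit_allowed = false for this seat).

NUMBERS. V_LJ(r) = r⁻¹²/12 − r⁻⁶/6 < 0 iff r > 2^{-1/6} ≈ 0.8909 (so an inserted particle at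
distance ≥ 9/10 from all others
only gains); two-shell window ε = 1/20, a ∈ [47/50, 1]; kissing-direction covering radius of
cuboctahedron and
anticuboctahedron = 45° (square-face centres), whence max distance from a point at distance r ∈
[9/10,1] of a good
centre to the nearest first-shell neighbour ≤ 0.766 + 0.05 = 0.816 < 9/10; polytype gap Δ₂(fcc−hcp)
≈ 7.27e-5 vs
bulk local gap ~1e-2 per particle (FreeSplittingCertificates census); Hales strong dodecahedral
bound (HalesDSP2012 Thm 8.44).

DEFINITION REQUESTS. None: Exposed is inlined; IsTwoShellGood
(Literature.Geometry.DiscreteGeometry.TwoShellPatterns) and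
PrestressSplitKorn.LayeredNear (Theorems/ReggeStarCoercivityDefectFreeCrystallizesDefs) exist.

Novelty: Searches (2026-08-30): read all 82 Theses titles/theses of the sub and the cell census
COSTUME-CENSUS-v1 (45 live-route rows,
30 side-targets); rg "Exposed|NoFoam|foam|vacancy fraction|surface fraction" over
Crystallization/Theses (hits: SurfaceTensionNoFoam
only); rg "crystallization_of_fractions|PeriodicGivenLayered_of" (landed, cited by no open route's
closes); ledger negatives
(24 refuted; nearest ShellCensus 15929). lit: BlancLewin2015 §2.3 survey (no a.e.-two-shell or
no-foam theorem for LJ in d=3 in print).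
Nearest prior art found: route SurfaceTensionNoFoam (items NoFoam stmt-AtomisticToContinuum-2912
moot, ExposedSitesCost,
DeloneMinimisersChargePeriodic): surface/bulk cut with SUFFICIENT-type halves; route
PhononSlackCertificates (NearFarGlueR /
NearFieldConvexity: sufficient engines for F1/F2).
Delta: the first filing of the NECESSARY halves of the landed two-fraction glue, split exactly by
vacuum adjacency so that each
piece violates a hypothesis of the barrier that kills the cell's current residual
StrictSplittingRule.
Claimed grade: new-combination  [refs: BlancLewin2015]

Barriers (technique_class: barrier-complement-carving defect-density rigidity): - technique_class: barrier-complement-carving defect-density rigidity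
- Literature.Barriers.AtomisticToContinuum.ShortRangeStackingBlindness: evaded by construction — all
three pieces are stacking-blind (fcc ∨ hcp; every Hägg word admitted in LayeredNear); stacking
selection is the landed PeriodicGivenLayered_of.
- Literature.Barriers.AtomisticToContinuum.HcpNotBravais: no piece quantifies over Bravais lattices.
- Literature.Barriers.AtomisticToContinuum.AperiodicTilingGroundStates: no piece is an exact local
rule / certificate; the instrument is the ε-deficit rung stmt-12562.
- Literature.Barriers.AtomisticToContinuum.SutoDegenerateGroundStates: LJ violates Sütő's hypotheses
(φ̂ ≥ 0, band-limited); used only as the separating class showing the F1/F2 layer is UNDECIDED above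
C in general.
- Literature.Barriers.AtomisticToContinuum.KissingTwelveDegeneracy: InteriorTwoShellOrder is a
two-shell (18-point) statement; Cohesion names no shell.
- Literature.Barriers.AtomisticToContinuum.FlexibleKissingArrangements: no contact-graph rigidity is
claimed; the target patterns are the rigid fcc/hcp two-shell clusters with tolerance 1/20.
- Literature.Barriers.AtomisticToContinuum.FccPolarTriplesUnlocking: StrainRelaxation uses the
smooth LJ energy (phonon positivity), not contact counting with six balls held.
- Literature.Barriers.AtomisticToContinuum.TetrahedralFrustration: it does not evade it for
InteriorTwoShellOrder; the bet is that an ε-deficit two-shell LP certificate with margin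

sub-problem: Crystallization · status: open · opened planner-decomp-a2c-lens-6-g0-0 2026-08-30T01:37:30Z · rev 0 · ledger route-AtomisticToContinuum-CohesionFrustrationStrain
GENERATED by the gate from the ledger (D-0016/17). Provers cite these decls: `theorem foo : Summit.AtomisticToContinuum.Crystallization.Theses.CohesionFrustrationStrain.<Decl> := …` in Summits/AtomisticToContinuum/Crystallization/Theorems/<Name>.lean.
-/

namespace Summit.AtomisticToContinuum.Crystallization.Theses.CohesionFrustrationStrain

open scoped BigOperators Topology Manifold Classical MeasureTheory ProbabilityTheory Matrix InnerProductSpace ComplexConjugate ContinuousMap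
open Filter Set Function TopologicalSpace MeasureTheory

attribute [summit_statement] _root_.Crystallization

/-- item stmt-AtomisticToContinuum-24039 · crux · rank 2 · open · by planner
why it might fail: tetrahedral frustration: icosahedral / Frank–Kasper / polytetrahedral interior environments within o(1)·N of the ground energy at positive density (Rogers–Hales local bounds are not sharp; LJ tail rewards over-dense shells).
sources: HalesDSP2012, FlatleyTheil2015, BlancLewin2015, Literature.Barriers.AtomisticToContinuum.TetrahedralFrustration, stmt-AtomisticToContinuum-12562
[crux] along every sequence of Lennard-Jones ground states the fraction of particles that are not
exposed (every point within distance 1 of the particle has a particle centre within 9/10) and are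
not (1/20,[47/50,1])-two-shell-good tends to zero — the frustration kernel of F1. [difficulty:
open-problem] -/
@[route_item "route-AtomisticToContinuum-CohesionFrustrationStrain", crux]
def InteriorTwoShellOrder : Prop :=
  ∀ x : (N : ℕ) → (Fin N → EuclideanSpace ℝ (Fin 3)), (∀ N, Literature.MathematicalPhysics.StatisticalMechanics.IsGroundState Literature.MathematicalPhysics.StatisticalMechanics.lennardJones (x N)) → Filter.Tendsto (fun N : ℕ => (Nat.card {i : Fin N // (∀ y : EuclideanSpace ℝ (Fin 3), dist y (x N i) ≤ 1 → ∃ j : Fin N, dist y (x N j) ≤ 9 / 10) ∧ ¬ Literature.Geometry.DiscreteGeometry.IsTwoShellGood (1 / 20) (47 / 50) 1 (x N) i} : ℝ) / N) Filter.atTop (nhds 0)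

/-- item stmt-AtomisticToContinuum-24040 · crux · rank 3 · open · by planner
why it might fail: the radius 9/10 is tight against relaxed close packing (hole covering radius ≈ 0.71–0.77 after 6% contraction): a strained but crystalline bulk could expose sites at positive density, making the piece false while F1 holds only if the good-window excludes it (it does: margin 0.08).
sources: BlancLewin2015, HeitmannRadin1980, Theil2006, stmt-AtomisticToContinuum-2912
[crux] along every sequence of Lennard-Jones ground states the fraction of exposed particles — those
with a point y, dist y (x i) ≤ 1, whose open 9/10-ball contains no particle centre — tends to zero
(no foam / no internal surface of positive density). [difficulty: L] -/
@[route_item "route-AtomisticToContinuum-CohesionFrustrationStrain", crux]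
def Cohesion : Prop :=
  ∀ x : (N : ℕ) → (Fin N → EuclideanSpace ℝ (Fin 3)), (∀ N, Literature.MathematicalPhysics.StatisticalMechanics.IsGroundState Literature.MathematicalPhysics.StatisticalMechanics.lennardJones (x N)) → Filter.Tendsto (fun N : ℕ => (Nat.card {i : Fin N // ∃ y : EuclideanSpace ℝ (Fin 3), dist y (x N i) ≤ 1 ∧ ∀ j : Fin N, 9 / 10 < dist y (x N j)} : ℝ) / N) Filter.atTop (nhds 0)

/-- item stmt-AtomisticToContinuum-24041 · crux · rank 4 · open · by planner
why it might fail: sparse (o(N)) two-shell defects can still bend layers: a dislocation/disclination network of vanishing density but divergent strain reach makes LayeredNear η fail at positive density for small η unless elastic energy controls the far field.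
sources: FrieseckeJamesMueller2002, Theil2006, FlatleyTheil2015, stmt-AtomisticToContinuum-13958, stmt-AtomisticToContinuum-11778
[crux] along every sequence of Lennard-Jones ground states whose two-shell-bad fraction tends to
zero, for every η > 0 the fraction of particles whose 2-ball is not η-layered-near
(PrestressSplitKorn.LayeredNear η: two-way η-matching with a rigid image of a layered template of
arbitrary Hägg word, a ∈ [47/50,1], interlayer increments in [39a/50,17a/20]) tends to zero.
[difficulty: L] -/
@[route_item "route-AtomisticToContinuum-CohesionFrustrationStrain", crux]
def StrainRelaxation : Prop :=
  ∀ x : (N : ℕ) → (Fin N → EuclideanSpace ℝ (Fin 3)), (∀ N, Literature.MathematicalPhysics.StatisticalMechanics.IsGroundState Literature.MathematicalPhysics.StatisticalMechanics.lennardJones (x N)) → Filter.Tendsto (fun N : ℕ => (Nat.card {i : Fin N // ¬ Literature.Geometry.DiscreteGeometry.IsTwoShellGood (1 / 20) (47 / 50) 1 (x N) i} : ℝ) / N) Filter.atTop (nhds 0) → ∀ η : ℝ, 0 < η → Filter.Tendsto (fun N : ℕ => ((Finset.univ.filter fun i : Fin N => ¬ (∃ (A : EuclideanSpace ℝ (Fin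 3) →ₗᵢ[ℝ] EuclideanSpace ℝ (Fin 3)) (t : EuclideanSpace ℝ (Fin 3)) (a : ℝ) (s : ℤ → ℤ) (z : ℤ → ℝ), (47 / 50 ≤ a ∧ a ≤ 1 ∧ ∀ m : ℤ, 39 / 50 * a ≤ z (m + 1) - z m ∧ z (m + 1) - z m ≤ 17 / 20 * a) ∧ Literature.MathematicalPhysics.StatisticalMechanics.IsHaggSeq s ∧ let S : Set (EuclideanSpace ℝ (Fin 3)) := Set.range fun l : ℤ × ℤ × ℤ => A (((l.2.1 : ℝ) • Literature.MathematicalPhysics.StatisticalMechanics.triangularVec₁ a) + ((l.2.2 : ℝ) • Literature.MathematicalPhysics.StatisticalMechanics.triangularVec₂ a) + ((Literature.MathematicalPhysics.StatisticalMechanics.haggLabel s l.1 : ℝ) • Literature.MathematicalPhysics.StatisticalMechanics.barlowOffset a) + (z l.1 • Literature.MathematicalPhysics.StatisticalMechanics.layerNormal 1)); (∀ j : Fin N, dist (x N j) (x N i) ≤ 2 → ∃ p ∈ S, dist (x N j + t) p ≤ η) ∧ (∀ p ∈ S, dist p (x N i + t) ≤ 2 → ∃ j : Fin N, dist (x N j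 + t) p ≤ η))).card : ℝ) / N) Filter.atTop (nhds 0)

/-- item stmt-AtomisticToContinuum-24042 · support · rank 9 · open · by planner
sources: stmt-AtomisticToContinuum-14970, stmt-AtomisticToContinuum-11779, BlancLewin2015
[support] the landed two-fraction glue, PROVED in tree
(Theorems/PhononSlackCertificatesNearFarGlueRRouteNeeds.lean,
`PhononSlackCertificatesNearFarGlueR.crystallization_of_fractions`): (F1: a.e. particle
two-shell-good along every ground-state sequence) → (F2: ∀ η > 0 a.e. particle η-layered-near) →
Crystallization; restated by delta-expansion of PrestressSplitKorn.LayeredNear only because that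
module has no hub olean today (lean check rc 75 remote:stale:148:unbuilt) — closes by `exact
crystallization_of_fractions` once the build backlog clears. [difficulty: provable-now] -/
@[route_item "route-AtomisticToContinuum-CohesionFrustrationStrain", crux]
def FractionsGlue : Prop :=
  (∀ x : (N : ℕ) → (Fin N → EuclideanSpace ℝ (Fin 3)), (∀ N, Literature.MathematicalPhysics.StatisticalMechanics.IsGroundState Literature.MathematicalPhysics.StatisticalMechanics.lennardJones (x N)) → Filter.Tendsto (fun N : ℕ => (Nat.card {i : Fin N // ¬ Literature.Geometry.DiscreteGeometry.IsTwoShellGood (1 / 20) (47 / 50) 1 (x N) i} : ℝ) / N) Filter.atTop (nhds 0)) → (∀ x : (N : ℕ) → (Fin N → EuclideanSpace ℝ (Fin 3)), (∀ N, Literature.MathematicalPhysics.StatisticalMechanics.IsGroundState Literature.MathematicalPhysics.StatisticalMechanics.lennardJones (x N)) → ∀ η : ℝ, 0 < η → Filter.Tendsto (fun N : ℕ => ((Finset.univ.filter fun i : Fin N => ¬ (∃ (A : EuclideanSpace ℝ (Fin 3) →ₗᵢ[ℝ] EuclideanSpace ℝ (Fin 3)) (t : EuclideanSpace ℝ (Fin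 3)) (a : ℝ) (s : ℤ → ℤ) (z : ℤ → ℝ), (47 / 50 ≤ a ∧ a ≤ 1 ∧ ∀ m : ℤ, 39 / 50 * a ≤ z (m + 1) - z m ∧ z (m + 1) - z m ≤ 17 / 20 * a) ∧ Literature.MathematicalPhysics.StatisticalMechanics.IsHaggSeq s ∧ let S : Set (EuclideanSpace ℝ (Fin 3)) := Set.range fun l : ℤ × ℤ × ℤ => A (((l.2.1 : ℝ) • Literature.MathematicalPhysics.StatisticalMechanics.triangularVec₁ a) + ((l.2.2 : ℝ) • Literature.MathematicalPhysics.StatisticalMechanics.triangularVec₂ a) + ((Literature.MathematicalPhysics.StatisticalMechanics.haggLabel s l.1 : ℝ) • Literature.MathematicalPhysics.StatisticalMechanics.barlowOffset a) + (z l.1 • Literature.MathematicalPhysics.StatisticalMechanics.layerNormal 1)); (∀ j : Fin N, dist (x N j) (x N i) ≤ 2 → ∃ p ∈ S, dist (x N j + t) p ≤ η) ∧ (∀ p ∈ S, dist p (x N i + t) ≤ 2 → ∃ j : Fin N, dist (x N j + t) p ≤ η))).card : ℝ) / N) Filter.atTop (nhds 0)) → _root_.Crystallization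

/-- item stmt-AtomisticToContinuum-24043 · assembly · rank 1 · open · by planner
sources: BlancLewin2015, stmt-AtomisticToContinuum-14970
[assembly] Cohesion → InteriorTwoShellOrder → StrainRelaxation → FractionsGlue → Crystallization
(union bound, modus ponens, the proved two-fraction glue). -/
@[route_item "route-AtomisticToContinuum-CohesionFrustrationStrain"]
def Assembly : Prop :=
  Cohesion → InteriorTwoShellOrder → StrainRelaxation → FractionsGlue → _root_.Crystallization

/-! D-0027 §2.1 — DECIDING THEOREM (planner-authored via `route open/edit --closes-file`; by planner-decomp-a2c-lens-6-g0-0 2026-08-30T01:37:30Z):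
its hypotheses are this route's items and its conclusion the sub-problem Statement (glue_lint), and it elaborates with this file. -/

@[closes "route-AtomisticToContinuum-CohesionFrustrationStrain"] theorem closes (h₁ : Cohesion) (h₂ : InteriorTwoShellOrder) (h₃ : StrainRelaxation) (h₄ : FractionsGlue) :
    _root_.Crystallization := by
  have hF1 : ∀ x : (N : ℕ) → (Fin N → EuclideanSpace ℝ (Fin 3)), (∀ N, Literature.MathematicalPhysics.StatisticalMechanics.IsGroundState Literature.MathematicalPhysics.StatisticalMechanics.lennardJones (x N)) →
      Filter.Tendsto (fun N : ℕ => (Nat.card {i : Fin N // ¬ Literature.Geometry.DiscreteGeometry.IsTwoShellGood (1 / 20) (47 / 50) 1 (x N) i} : ℝ) / N) Filter.atTop (nhds 0) := by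
    intro x hx
    have hA := h₁ x hx
    have hB := h₂ x hx
    have hAB := hA.add hB
    rw [add_zero] at hAB
    refine squeeze_zero (fun N => by positivity) (fun N => ?_) hAB
    rw [← add_div]
    apply div_le_div_of_nonneg_right _ (Nat.cast_nonneg N)
    have count : ∀ (E G : Fin N → Prop), Nat.card {i : Fin N // ¬ G i} ≤
        Nat.card {i : Fin N // E i} + Nat.card {i : Fin N // ¬ E i ∧ ¬ G i} := by
      intro E G
      classical
      simp only [Nat.card_eq_fintype_card, Fintype.card_subtype]
      calc (Finset.univ.filter fun i => ¬ G i).card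
          ≤ ((Finset.univ.filter fun i => E i) ∪ (Finset.univ.filter fun i => ¬ E i ∧ ¬ G i)).card := by
            apply Finset.card_le_card
            intro i hi
            simp only [Finset.mem_filter, Finset.mem_union, Finset.mem_univ, true_and] at hi ⊢
            by_cases hE : E i
            · exact Or.inl hE
            · exact Or.inr ⟨hE, hi⟩
        _ ≤ _ := Finset.card_union_le _ _
    have key := count (fun i : Fin N => ∃ y : EuclideanSpace ℝ (Fin 3), dist y (x N i) ≤ 1 ∧ ∀ j : Fin N, 9 / 10 < dist y (x N j)) (fun i : Fin N => Literature.Geometry.DiscreteGeometry.IsTwoShellGood (1 / 20) (47 / 50) 1 (x N) i)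
    have hcongr : Nat.card {i : Fin N // ¬ (∃ y : EuclideanSpace ℝ (Fin 3), dist y (x N i) ≤ 1 ∧ ∀ j : Fin N, 9 / 10 < dist y (x N j)) ∧ ¬ Literature.Geometry.DiscreteGeometry.IsTwoShellGood (1 / 20) (47 / 50) 1 (x N) i} =
        Nat.card {i : Fin N // (∀ y : EuclideanSpace ℝ (Fin 3), dist y (x N i) ≤ 1 → ∃ j : Fin N, dist y (x N j) ≤ 9 / 10) ∧ ¬ Literature.Geometry.DiscreteGeometry.IsTwoShellGood (1 / 20) (47 / 50) 1 (x N) i} := by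
      apply Nat.card_congr
      apply Equiv.subtypeEquivRight
      intro i
      simp only [not_exists, not_and, not_forall, not_lt]
    rw [hcongr] at key
    exact_mod_cast key
  exact h₄ hF1 (fun x hx => h₃ x hx (hF1 x hx))

end Summit.AtomisticToContinuum.Crystallization.Theses.CohesionFrustrationStrain
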